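import Literature.MathematicalPhysics.QuantumFieldTheory.Balaban1983to89.DagBinding
import Literature.MathematicalPhysics.QuantumFieldTheory.Balaban1983to89.B14Eq02Iterate
import Literature.MathematicalPhysics.QuantumFieldTheory.Balaban1983to89.B14Eq111Resummation

/-!
# `Balaban1983to89.B14Carve33Sects01Hyp` — [Balaban1988Convergent] pp. 243–253 (+ p. 254 ll. 1–19): Sect. 0 (the
# induction (0.1)–(0.2), the ASSUMED operation 𝐑 p. 244, the unnumbered THEOREM p. 245) and Sect. 1 "The First
# Renormalization Transformation" (1.1)–(1.30): P6 CARVING-FAN BLOCK 33 — the block's residual printed sentences in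
# hypothesis form and ONE hypothesis bundle `Hyp` of the section's printed statements BY NAME, keyed to the consumer
# (`stmt-QuantumFields-20542`, K1⁷, DAG node n11 [B14] = the `rOperation` leaf `DagBinding.ROpLeaf` over
# `DagBinding.PrintedCarriers14R`)

statement-level skeleton of published theorems with citation tags; proofs where landed; nothing here is a claim about the
Yang–Mills mass gap

T. Bałaban, *Convergent renormalization expansions for lattice gauge theories*, Commun. Math. Phys. **119** (1988) 243–285,
doi:10.1007/BF01217741 `[Balaban1988Convergent]` (cell paper "B14" = «[III]» of [Balaban1989LargeFieldI/II]; its «[I]» =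
[Balaban1987RG1] (B12), «[II]» = [Balaban1988RG2Cluster] (B13), «[12]» = [Balaban1985Averaging] (B7), «[14]» =
[Balaban1985RegularSpaces] (B8), «[15]» = [Balaban1985Variational] (B11), «[16]» = [Balaban1985UV3] (B10), «[18]» =
[BalabanImbrieJaffe1985]; printed page = PDF page + 242).  STATUS: published, refereed.  PDF held:
`paper:balaban1988-cmp119-convergent-renormalization`; pp. 243–254 [PDF 1–12] read by this seat on the text layer
(`p0001.txt` … `p0012.txt`, line locators below) and AS IMAGES on the x2 renders
`run/shared/lean/pub/pub-balaban/b2b-balaban-ref1/pages/1988-cmp119-convergent-renormalization/…-p002,p004,p005,p006,p010,p011,p012-x2.png`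
(crops of p. 248, p. 252, p. 253 for the three residual sentences), 2026-08-28.

CITATION HEADER (lean-in-tree rule).  Cell `lit-balaban` (HOME `run/shared/lean/pub/lit-balaban/`), P6 CARVING FAN
(D-0154 (3b)), block 33 of `carve/BLOCKS-31-40.md` v1.1 (lead g30, 2026-08-28T05:52Z; claimed by seat `carve-07` g4 under
RULING #7 (5) / RULING #8, `carve/STATUS.md` 07:28:11Z / 07:30:58Z): «[B14] pp. 243–253, Sects. 0–1: the operation 𝐑 p.244,
Thm (unnumbered) p.245, first renormalization transformation (1.1)–(1.30); 34 SKELETON rows; KEY stmt-QuantumFields-20542,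
also-feeds 20544, 20541».  Filed `--supports stmt-QuantumFields-20542 --as helper`.  RULES (`carve/CARVE-RULES.md` §2): IN
TREE = CITE, NEVER RESTATE; residual printed statements in hypothesis form `def …Printed : Prop`; ONE bundle `Hyp`; no
`instance`, no `notation`, 0 `sorry`.

## WHAT THE BLOCK'S PAGES PRINT AND WHERE THE TREE HOLDS IT (cite table — all 34 SKELETON rows of block 33 are IN TREE;
## nothing in this table is restated below; FQ prefix `Literature.MathematicalPhysics.QuantumFieldTheory.Balaban1983to89.`;
## names are cited CARVE-LIST style as `<FileStem>.<decl>` — the Lean namespace of a stem `B14Xyz.lean` is `B14.Xyz` or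
## `B14Xyz` as declared in that file, e.g. `B14.Eq111Resummation`, `B14.Sect1Repr`, `B14Sect1Sets`, `B14Eq16Proof`)
* row B14.Eq0.1 — (0.1) p. 243 `(Tρ)(V) = ∫dU δ(ŪV⁻¹)ρ(U)`: `Setup`'s `IsRT` (push-forward reading), `RTOp` / `RTOpI` (the
  operator `T`); the averaging `Averaging`.
* row B14.Eq0.2 — (0.2) p. 244 `ρ_k = 𝐑Tρ_{k−1} = (𝐑T)^kρ₀`, «we finish the inductive procedure when we reach the unit lattice»:
  `B14.Eq02Iterate.rho` / `RT` / `RTpow` / `rho_eq_RTpow` / `rho_unit` / `densityRGI` (PROVED, with body), `Step.DensityRGI`,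
  `T4ObservableTelescope.PrintedChain`; the Wilson start `ρ₀ = exp[−(1/g₀²)A − E]`: `B14.Sect1Repr.rho0`
  (`B14Eq16Proof.rho0_gaugeAct`, `rho0_pos_le`).
* p. 244 ll. 19–29 (the large-plaquette restriction «|U(∂p) − 1| ≧ g₀p₀(g₀) … p₀(g₀) = A₀(log g₀⁻²)^{p₀}», the unnumbered display
  «exp[−(1/g₀²)[1 − Re tr U(∂p)]] ≦ exp(−½p₀²(g₀)) ≦ g₀^{A₀(log g₀⁻²)^{p₀}−1}», «For d < 4 … g₀ = gε^{½(4−d)} … arbitrarily large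
  power of ε», «For d = 4 the bare coupling constant behaves asymptotically as (a + b log ε⁻¹)^{−1/2} … does not give any
  positive power of ε»): `B14LargeFieldFactorD4.exp_action_le_exp_neg_half_sq`, `rpow_eq_exp_neg_half_p0Profile`,
  `exp_neg_half_p0Profile_sq_le_rpow`, `largeFieldFactor_le_eps_pow_of_d_lt_four`, `inv_sq_bareD4`,
  `tendsto_largeFieldFactor_bareD4_zero`, `not_eventually_largeFieldFactor_le_pow`, `isLittleO_pow_largeFieldFactor_bareD4`
  (PROVED; the profile `p₀(g)` = `Setup.p0Profile`).
* row B14.Def@244R — p. 244 «The operation 𝐑 serves this purpose. We will not describe it here, we will only assume that it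
  has some properties incorporated in the inductive description of the effective actions»: `B14.RAssumedP244`, bound for the
  K1⁷ DAG as `DagBinding.ROpLeaf` over `DagBinding.PrintedCarriers14R` (`rOpLeaf_iff`).  — bundle member `r244`.
* row B14.Thm@245 — THEOREM p. 245 «If ρ_k satisfies the assumptions described in detail in Sect. 2, then Tρ_k satisfies
  also the corresponding assumptions»: `B14.ThmP245Printed` / `ThmP245Spaces` and, over the inhabited carrier,
  `B14.ThmP245PrintedI` / `ThmP245SpacesI` with the bookkeeping `thmP245PrintedI_of_spacesI`, `mapsSpaces_of_thmP245SpacesI`,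
  `inductiveAssumptions_of_thmP245I`, `inSpace_all_of_thmP245SpacesI`, `thm1Printed_of_thmP245I` (Thm 1 p. 262 ⇐ start +
  p. 245 Theorem + assumed 𝐑); DAG side `DagBinding.ROpLeaf.thmP245SpacesI_iff`, `ROpLeaf.mapsSpacesI`,
  `ROpLeaf.mapsSpaces_of_thmP245SpacesI`, `ROpLeaf.inSpace_all_of_thmP245SpacesI`.  — bundle member `thm245` (sequence reading).
* row B14.Def§1.scales — p. 245 ll. 28–36 (the partitions into MR₀- and LM₂R₀-cubes, «R₀ is the smallest power of L such that
  R₀ ≧ (log g₀⁻²)^r, r ≧ 2, and M = L^m», «M₂ = L^{m₂}, and M₁ < M₂ < M … we can take M₂ = L²M₁», compatibility of the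
  partitions, the operation ~): `B14Sect1Scales.PowersOfL`, `PowersOfL.order`, `compatible_of_powersOfL`, `fine_dvd_coarse`;
  `Setup.Consts` / `Consts.ScalesOrdered` («M₁ < M₂ < M», «r ≧ 2», «p₀ ≧ 5r»); `B14.IsRj` ((2.5), the general `R_j`, also
  p. 246 l. 17 «R₁ is the smallest power of L such, that R₁ ≧ (log g₁⁻²)^r»); the layer operations: `B14DomainGeom.enl`, `innerN`.
* rows B14.Eq1.1, B14.Eq1.4, B14.Eq1.8, B14.Eq1.1-1.8 — the decompositions of unity (1.1) p. 246, (1.4) p. 246, (1.8) p. 247: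
  `B14Sect1Sets.decompUnity`, `decompUnity_term_eq_one_iff` (PROVED, abstract), `B14.Sect1Repr.eq11`, `eq14` (PROVED, concrete),
  `B14.Eq111Resummation.eq18_zero`, `B14Eq18Concrete.eq18_concrete`; the χ's: `B14.Sect1Repr.chi0`, `chi0c`, `chi1`, `chi1c`,
  `chiAx`, `B14.Sect3Decomp.chiPrime` / `chiPrimec` at `k = 0` (`B14.Eq111Resummation.sect3Zero`); the thresholds: «ε₀ =
  g₀p₀(g₀), p₀(g₀) = A₀(log g₀⁻²)^{p₀}, p₀ ≧ 5r and A₀ is a sufficiently large constant» p. 246 ll. 5–7 = `Setup.p0Profile`,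
  `Setup.epsK`, `Consts.ScalesOrdered`; «ε₁ = g₁p₀(g₁)» p. 246 l. 34; «δ₀ = g₀A₁p₀(g₀) = (A₁/A₀)ε₀. We assume that the constant
  A₀ is much larger than A₁» p. 247 ll. 36–37 = `Setup.deltaK`, `B14Eq18Concrete.deltaK_eq_ratio_mul_epsK` (PROVED); the second
  (not adopted) choice «ε₀ = g₀A₀(log γ₀⁻²)^{p₀}, γ₀⁻² = γ⁻² + β log ε⁻¹» p. 246 ll. 7–12 is a definition print itself sets aside
  («we assume here that ε₀ is given by the first formula») — not typed.
* row B14.§1 (sets) and rows B14.Eq1.10, B14.Def@396-type geometry — p. 246 «P₀′, P₀′~», «P₁ ⊂ (P₀′~)ᶜ», «P₁¹ = ((P₀′~)ᶜ∩(P₀′~²)ᶜ)^{(1)}»,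
  (1.9) p. 247 «X* = X∖{b₀(c) : c ∈ X^{(1)}}», (1.10) p. 248 «Ω₁ = (Q₁′~² ∪ (B(P₁¹)ᶜ)~³)ᶜ = (Q₁′~²)ᶜ ∩ (B(P₁¹))~⁻³ … a distance
  between Ω₁ and the union of the large field regions is at least 2LMR₁. On the set Ω₁~ we have only the small field
  characteristic functions»: `B14Sect1Sets.P11Printed`, `P11Printed_collapse` (the printed `P₁¹` does not involve `P₁′`, cell
  GAPS G-adv5-6), `P11With`, `Omega1`, `omega1_two_forms`, `omega1_subset_compl_enl_Q1'`, `omega1_far_P0'_printed`,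
  `printed_reading_unconstrained`, `enl_omega1_subset`, `margin_adv5_7`; `B14.StarSet.star`, `mem_star`; as hypotheses of the
  resummation: `B14.Eq111Resummation.Geom`, `Geom.Adm110`.  — bundle member `adm110`.
* row B14.Eq1.2 + p. 246 l. 28 «The function in (1.2) depends on the field V restricted to □′~⁴» — `B14.Sect1Repr.Sect1Data`,
  `U1loc` (DEFINED), `U1locDependsOn` (the sentence, typed) with `B14Eq12Locality.u1locDependsOn_of_local`,
  `B14Eq12LocalityQsstar.u1locDependsOn_of_qsstarG`, `B14Eq12InteriorLocality.exists_interiorLocal` (PROVED under locality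
  data).  — bundle member `dep12`.
* row B14.Eq1.3 — (1.3) `Q₁^{s*}V`: `BalabanImbrieJaffe1984to88.BIJ85Sect2SurfaceAverages.BlockBonds.Qsstar`,
  `B14Eq12LocalityQsstar.qsstarG_local`.
* row B14.Claim@246 — p. 246 ll. 12–14 «If a plaquette p′ is contained in (P₀ᶜ)^{(1)}, then Proposition 1 [12] implies that the
  new field V satisfies the bound |V(∂p′) − 1| < 2L²ε₀»: `B14.Claim246.Claim246Printed`, PROVED `Claim246Printed_holds`.
* rows B14.Eq1.5, B14.Eq1.6, B14.Eq1.7 — (1.5) the axial gauge fixing, (1.6) «This yields the equality ρ₁(V) = Σ_{P₀P₁} …»,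
  (1.7) 𝐆: `B12FaddeevPopov016.fpIntegrand`, `B14Eq15Concrete.eq15_concrete`, `B14Eq16FaddeevPopov.integral_eq_integral_weight_mul`,
  `weight_eq`; `B14.Sect1Repr.integrand16`, `rho1Rhs`, `Eq16` (the claim (1.6), typed), PROVED for the [I] (0.13) kernel class
  and in the push-forward reading: `B14Eq16Proof.eq16`, `isRT_eq16`; `Setup.gaugeFixFn` (1.7).  — bundle member `eq16`.
* p. 247 ll. 14–22 (the remark that the gauge fixing by δ-functions of the contour variables averaged over the Euclidean
  transformations of the block «has all the properties necessary … so it can be an alternative to the above definition») —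
  a methodological remark without a statement; not typed.
* row B14.Claim@247 — p. 247 ll. 25–29 «|UU_{0,□}⁻¹ − 1| < O(L²)ε₀ on □′~². A domain of this type, with O(L²) replaced by a
  small constant, is also contained in the domain of integration in (1.6)»: `B14.Claim247.Claim247Printed`
  (`Claim247Printed_holds`), `B14Claim247Avg.Claim247AvgPrinted` (`_holds`), `B14Claim247Soft.Claim247SoftPrinted` (`_holds`)
  — PROVED.
* row B14.Claim@249 + p. 249 ll. 9–10 «The number |Ω₁*| is the number of bonds belonging to Ω₁ minus the number of bonds in the
  set {b₀(c) : c ∈ Ω₁^{(1)}}»: `B14.StarSet.card_star`, `B14StarSetBlocks.card_starBlocks` (PROVED).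
* row B14.Eq1.11 — (1.11) p. 248 (the resummation over `P₀, P₁, Q₁` at fixed `Ω₁`, «as in (8) [16]», `ζ(Ω₁ᶜ)`):
  `B14.Eq111Resummation.adm`, `admOmega`, `term`, `zeta`, `front`, `dropped`, `term_eq_dropped_mul`, `term_eq`, `resum`,
  `sum16_mul18`, `eq111_of_eq16`, `isRT_eq111` — PROVED modulo the binder `hdrop` (= the p. 248 drop sentence, a RESIDUAL of
  this block: `Drop248Printed` below) and the (1.10) inclusions `Geom.Adm110`.
* row B14.Eq1.12 + p. 248 ll. 22–26 — (1.12) the variational problem, «It is equal to the critical point of the action A(U)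
  only, on the subspace … and the axial gauge conditions», «By Theorem 1 [15] there exists exactly one critical point of (1.12)
  in the domain of integration in (1.11), for ε₀ sufficiently small. It is a minimum of (1.12), with a strictly positive second
  order differential»: `B14.Eq112Variational.F112`, `C112`, `Ax112`, `argmin112`, `argminAx`, `argmin112_eq_argminAx`
  (PROVED), `existsUnique_argmin112_iff`; the cited [15] Theorem 1 = `B11.Thm1Printed` (row B11.Thm1; existence is NOT
  asserted in `B14Eq112Variational`, it is [15]'s theorem) — bundle member `thm1_15` cites it BY NAME; the [I] twin
  `B12CriticalPoint23`.
* row B14.Eq1.13 + p. 248 ll. 26–30 «The field U′ is small, because U′ = UU₁⁻¹ = (UU_{1,□′}⁻¹)(U_{1,□′}U₁⁻¹), and both fields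
  … are small», (1.13) `A′ = (1/i) log U′`: `B14Eq113Fluctuation.norm_Uprime_sub_one_le`, `eq113_of_small`, `fluct_factor`
  (PROVED); `MatrixLog.mlog`.
* rows B14.Eq1.14-1.16, B14.Eq1.15-1.19 — (1.14)–(1.16) p. 249 (linearization, scaling `A = g₀A′`, «we remove the
  δ-functions … solving the equations (QA′)(c) = 0 … We denote this function by C … Hence A′ = CA … and we have QCA = 0», the
  Gaussian forms): `T4AdjointCovarianceWords.solveC`, `res_solveC`, `constraint_solveC` («QCA = 0», PROVED), `solveC_unique`,
  `blockOp`, `blockInv`, `condCov`, `complete_square`; `B14Eq116QuadraticForm.eq116_expansion`, `delta1Form`,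
  `eq116_quadratic_part`; p. 249 ll. 7–9 «the linearizing transformation is different from the identity only on bonds
  {b₀(c) : c ∈ Ω₁^{(1)}}, hence the characteristic function χ₀′(Ω₁) … is unchanged»: `B14.StarSet.b0_not_mem_star`,
  `B14Eq116QuadraticForm` header (the transformation acts on the `b₀(c)`-variables, `χ₀′` tests the starred bonds only).
  The CARVE-LIST mark «cite UNRESOLVED `~.T4AdjointCovariance`» of row B14.Eq1.15-1.19 resolves to the module
  `T4AdjointCovariance` (`prodAct`, `OpCovariant`, `invariant_pairing`, `invariant_gaussWeight`, `adFamily`, `SupSmallOn`).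
* p. 250 ll. 2–4 «it is very important … that we expand in (1.14) around the critical point, so the potentially dangerous
  linear term (1/g₀)⟨δA, A⟩ vanishes on the domain of integration»: `B14Eq116QuadraticForm.linear_term_vanishes`,
  `linear_term_vanishes_of_isMinOn`, `eq116_expansion_of_critical` (PROVED).
* row B14.Eq1.17 + p. 250 ll. 4–18 (gauge invariance (1.17) «U → U^u, A → R(u₋)A», «The characteristic function is invariant
  with respect to gauge transformations of the new field V: V → V^v … u₀(x) = v(y) for x ∈ B(y) … U₀ → U₀^{u₀} … the
  characteristic function χ₀′(Ω₁) is invariant if the field variables A are transformed by the adjoint representation A →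
  R(u₀)A»): `Setup.GaugeField.gaugeAct`, `B14Eq16Proof.chi0_gaugeAct`, `chi0c_gaugeAct`, `rho0_gaugeAct`,
  `B14Eq16FaddeevPopov.avg_gaugeAct_of_fineGauge`; `T4AdjointCovariance.adAct`, `adFamily`, `supSmallOn_adAct_iff`,
  `supSmallOn_adFamily_iff`, `invariant_charFn`, `invariant_pairing`, `invariant_gaussWeight`;
  `T4AdjointCovarianceWords.opCovariant_solveC`, `opCovariant_blockInv`, `opCovariant_condCov` (PROVED).
* rows B14.Eq1.18-1.19 — (1.18)–(1.19) p. 250 and «Thus the second function in the product (1.19) is equal to 1, and we can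
  omit it. These functions remain only for □′ ⊂ (Ω₁∖Ω₁~⁻¹) ∪ R₁ …», «|U₁U_{1,□′}⁻¹ − 1| < O(1)B₃·exp(−δLM₂R₁)ε₁, and the bound
  can be made much smaller than δ₀, if M₂R₁ is large enough»: `B14Eq118Concrete.eq118_concrete`, `eq119_remaining`,
  `second119_eq_one`, `B14.Eq119SecondFunction.secondFunction_eq_one`, `small_if_M2R1_large`, `eq119_bond_lt`,
  `B14Eq119From190.dev119_le_lattice_of_ineq190` (the bound, O(1) explicit, from (190) of [15]),
  `secondFunction119_eq_one_of_ineq190_M2R1` (PROVED; the [15] (190) input is `B11SectG.Ineq190`), `B14Eq124Jacobians.eq118`.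
* row B14.Eq1.20 — (1.20) p. 251 `S₁`, `Λ₁ = Ω₁~⁻² ∩ (R₁′~)ᶜ` and the box modification ll. 5–13 («components … contained in
  cubes of sizes smaller than 100LMR₁ … replace such components by the smallest rectangular parallelepipeds … This change is
  insignificant from the point of view of bounds»): `B14DomainGeom.lambda320_far_from_compl`, `B14BoxFix.bbox`, `ibox`,
  `bbox_isBox`, `bbox_subset_ibox`, `pass`, `pass_Z0`, `single_pass_fails` (located: one pass of the printed modification does
  not stabilise), `B14BoxFixWall.passW`.
* row B14.Eq1.21 + p. 251 ll. 19–32 ((1.21), «This function depends on V restricted to Ω₁∩Λ₁ᶜ», «𝐇_{1,Ax} depends on its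
  argument restricted to a small neighborhood of ∂Λ₁ (in fact one layer of M₁-cubes …). The dependence is analytic, and the
  function 𝐇_{1,Ax} has the exponential decay property. It was formulated in (190) Sect. G of [15] for the Landau gauge, but on
  the unit lattice it holds for any gauge … hence for the axial gauge too. … More precisely, we have |𝐇_{1,Ax}| <
  O(1)B₃exp(−δMR₁)ε₁, and the bound is much smaller than δ₀, for MR₁ large enough»): `B11AxialTransport190` (the Landau →
  axial transport of (190): `far_bound_sum`, `far_bound_meanValue` = the p. 251 bound at the level of shapes, PROVED from
  (190)), `B11SectG.Ineq190`, `B14From190SectG.dev119_le_lattice_sectG`.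
* rows B14.Eq1.22, B14.Eq1.23-1.25 + p. 252 ll. 2–20 — (1.22) the change of variables with the cut-off «g is a C^∞-function
  defined on the Lie algebra 𝐠, 0 ≦ g(A′) ≦ 1, g(A′) = 0 on {A′ ∈ 𝐠 : |A′| ≦ 4/3 g₀⁻¹δ₀}, g(A′) = 1 on {A′ ∈ 𝐠 : |exp ig₀A′ − 1|
  ≧ 5/3 δ₀}» (typed `B14.ChangeOfVariables.IsCutoff`,
  exhibited `B14Eq122CutoffExists.exists_isCutoff`, `isCutoff_one_sub_bump`), «F … at least linear in g₀A′(b), hence the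
  factor g₀⁻¹ is cancelled … suppressed by the bounds on 𝐇_{1,Ax}» (`B14.ChangeOfVariables.bF`, `norm_bF_le`,
  `norm_inv_g0_bF_le`), «For b ∈ S₁*∖(R₁~²)* … (1.22) with the function g(A′(b)) replaced by 1» (`newVarSimple`), (1.23) and
  «These changes of variables do not change the functions χ^{(0)} … After these changes of variables the characteristic
  functions depend on the new variables V restricted to the large field domain Λ₁ᶜ. It is the desired localization property»
  (`B14Eq123Localization.firstFactor_iff`, `secondFactor_iff`, `oldArg_eq`, `oldArg_eq_of_cutoff_one`, `exp_smul_newVar`),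
  (1.24) «The Jacobians … can be exponentiated, as in (20) [16]» (`B14Eq124Jacobians.eq124`, `eq124_bondwise`,
  `det_pos_of_norm_sub_one_lt`), (1.25) (`B14Eq124Jacobians.eq125_resummation`) — PROVED / DEFINED.
* p. 252 ll. 25–30 «we obtain a new expression V^{(0)}(S₁, A, 𝐇_{1,Ax}) … it is a sum over bonds b ∈ S₁ of the expressions which
  depend on A, 𝐇_{1,Ax} almost locally. The dependence on 𝐇_{1,Ax} is analytic, and the expressions are small, i.e., they can
  be bounded by any positive power of g₀» — NO declaration of record (`B14Eq124Jacobians` header: «the new action term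
  V^{(0)}(S₁, A, 𝐇_{1,Ax}) and its bounds ("bounded by any positive power of g₀")» NOT REPRODUCED) — RESIDUAL `SmallS1Terms252Printed`
  below; its §3 twin (3.22) p. 269 is `B14Eq322Analytic.norm_bH_le_pow`.
* row B14.Eq1.26 + p. 253 ll. 1–9 — (1.26) «This integral is equal to the corresponding conditional integral in the case
  analyzed in [I] … but with a different background field», «The above equalities define the functions V^{(0)} and 𝐄^{(1)}»:
  `B14Eq126CondGaussian.lhs126`, `mid126`, `Z0`, `V0`, `E1`, `gaussExpect`, `eq126_first`, `eq126_second`, `eq126`, `Z0_pos`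
  (PROVED, with bodies); `T4AdjointCovariance.restrictTo`, `T4AdjointCovarianceWords.condCov`, `complete_square`.
* p. 253 ll. 11–16 «we separate the clusters with localization domains close to Λ₁ᶜ, e.g., within the distance MR₁ to Λ₁ᶜ, and
  we denote the sum of these terms, and the expanded V^{(0)}(S₁), by 𝐁^{(1)}(U₁, Λ₁ᶜA, S₁). This is the boundary term, and it can
  be bounded by O(1)|Λ₁∩Λ₁ᶜ|; therefore it is controlled by the large field estimates, and does not need to be renormalized» —
  NO declaration of record (the §2 clauses (2.40)–(2.42) of the general boundary terms are `Step.LFTower.B`, `Step.LFHyp.boundB`,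
  `Step.LFHypB`, a per-localization-domain decay bound of a different shape) — RESIDUAL `BoundaryTerm253Printed` below, with
  the printed volume token «|Λ₁∩Λ₁ᶜ|» [sic] (the intersection of a set with its complement) kept as a PARAMETER and its
  literal reading kernel-checked to collapse (`boundaryTerm253_literal`).
* row B14.Eq1.27 + p. 253 ll. 17–29 (the renormalization: «subtracting the values at U₁ = 1, and the counterterm
  β₁(g₀)A(φ₁, U₁) … φ₁ ∈ C₀^∞(Λ₁), φ₁ = 1 on Λ₁~⁻¹», (1.27) «1/g₀² = 1/g₁²(x) + β₁(g₀)φ₁(x)», «on Λ₁~⁻¹ we have the same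
  equation, which defines the same coupling constant g₁»): `B14.LocalCoupling.invSq`, `eq127`,
  `invSq_eq_const_of_phi_eq_one` (PROVED); `B14Seam245.weightedAction`, `weightedAction_sub`, `weightedAction_seam_le`;
  `Setup.Flow.SatisfiesRG` ((I.0.20)).
* row B14.Eq1.28 — (1.28)–(1.30) pp. 253–254 (the representation `ρ₁(V) = Σ_{{Ω₁,Λ₁}} χ₁(Ω₁)𝐓₁({Ω₁,Λ₁}) exp A₁(1/g₁², U₁)`,
  the integral operation 𝐓₁ (1.29), the effective action A₁ (1.30), «Here we have combined the term log Z^{(0)}(Λ₁) with the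
  part of the previous function 𝐄^{(1)} … It coincides with the corresponding function constructed in [I], if the last is
  suitably restricted to the domain Λ₁», «The constant E₁ is obtained from E by subtraction of all the constants … Thus E₁
  depends on Ω₁, Λ₁»): `Step.Repr218` / `Repr218.Holds` (the representation (2.18) of which (1.28) is the case k = 1),
  `B14Eq218SeqSucc.sum_seq_zero`, `Step.LFActionData.action23`, `B14.Def2Ek.Ek`, `Ek_one` ((1.30): `E₁ = E − E^{(0)}`, the
  dependence on `Ω₁, Λ₁` entering through the datum `e 0`), `Step.TkOps` (the operations 𝐓_k); p. 254 ll. 17–19 «The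
  representation (1.28)–(1.30) will be generalized in the next section to an inductive description of the k-th effective
  density» = the `k = 0` instance of the p. 245 Theorem (`Hyp.firstStep` below).  The identification sentence «It coincides
  with the corresponding function constructed in [I] …» names no second object in the tree's currency ([I]'s 𝐄 is
  `B12…`'s cluster expansion on the full small-field lattice) and is recorded here only.

## WHAT THIS FILE ADDS
§1 THREE RESIDUAL PRINTED SENTENCES with no declaration of record (searched 2026-08-28: `rg` over `Balaban1983to89/*.lean` for
the printed phrases; the HOME census `EXISTING-DECLS.tsv` (6965 decls citing [Balaban1988Convergent]); found only as the
binder `hdrop` of `B14.Eq111Resummation.term_eq`/`resum`/`eq111_of_eq16`/`isRT_eq111`, resp. inside the NOT-REPRODUCED lists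
of `B14Sect1Sets` and `B14Eq124Jacobians`, resp. nowhere), typed in hypothesis form, each with a kernel-checked companion:
* `Drop248Printed` — p. 248 ll. 6–9: «On the set Ω₁~ we have only the small field characteristic functions, and it is easy to
  see that the functions χ₀, χ_{Ax} localized in Ω₁~ are equal to 1, if A₀ is sufficiently larger than A₁. We drop these
  functions from the integrals in (1.6).»  TYPED in the currency of the resummation file (the term of (1.6)·(1.8) labelled
  `(P₀, P₁, Q₁)`, its `Ω₁`, the dropped factor `χ₀(□(Ω₁~))χ_{Ax}((Ω₁~)^{(1)})`) ON THE DOMAIN OF INTEGRATION OF (1.6) — at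
  `V = Ū` (the δ-function `δ(ŪV⁻¹)`) and on the support of the small-field functions `χ₁(P₁ᶜ)(Ū)` (1.4), `χ₀′(Q₁ᶜ)(U, Ū)`
  (1.8) — with the printed thresholds `ε₀ = g₀p₀(g₀) = g₀A₀(log g₀⁻²)^{p₀}`, `ε₁ = g₁p₀(g₁)`, `2δ₀`, `δ₀ = g₀A₁(log g₀⁻²)^{p₀}
  = (A₁/A₀)ε₀` (`two_delta0_eq`), and «if A₀ is sufficiently larger than A₁» as `∃ a₀, ∀ A₀ ≧ a₀` at fixed `A₁`, the threshold
  quantified BEFORE the index of a family `inst : ι → Sect1Inst` of first-step situations (p. 246 «A₀ is a sufficiently large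
  constant», fixed before the bare coupling; the family convention of `B11.Thm1Printed` / `B14.Thm2Printed`); deliveries:
  `Drop248Printed.hdrop` (the binder of `resum` at `V = Ū`), `Drop248Printed.resum` (the resummation (1.11) of finite sums at
  `(U, Ū)` with NO drop binder left) and `Drop248Printed.isRT_eq111` ((1.11) in the push-forward reading of `∫dU δ(ŪV⁻¹)`, from
  `B14Eq16Proof.isRT_eq16` + `sum16_mul18` + `resum`, with NO drop binder left).
* `SmallS1Terms252Printed` — p. 252 ll. 27–30, the smallness clause «the expressions are small, i.e., they can be bounded by
  any positive power of g₀» for the bond terms of V^{(0)}(S₁, A, 𝐇_{1,Ax}), read «for every power N there is a threshold on g₀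
  below which every bond term is ≦ g₀^N» (the reading under which print's O(1)'s are absorbed; the §3 twin
  `B14Eq322Analytic.norm_bH_le_pow` keeps them); «almost locally» and «analytic» are NOT typed (no second object);
  `smallS1Terms252_mono` (a bound by `g₀^N` is a bound by `g₀^M`, `M ≦ N`, once `g₀ ≦ 1`).
* `BoundaryTerm253Printed` — p. 253 ll. 12–15 «This is the boundary term, and it can be bounded by O(1)|Λ₁∩Λ₁ᶜ|», typed AS
  PRINTED with the volume token a parameter `vol` (which set's volume is meant — print's «Λ₁∩Λ₁ᶜ» is empty — is NOT decided
  here); `boundaryTerm253_literal`: under the LITERAL token `vol = |Λ₁ ∩ Λ₁ᶜ| = 0` the bound forces `𝐁^{(1)} = 0`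
  (kernel-checked; a located print defect, not in the cell's GAPS.md at the time of filing).
§2 THE BUNDLE.  `Carriers V` — the parameters the section's printed statements take beyond the DAG record
`V : DagBinding.PrintedCarriers14R` (plain data, no instances): the family `inst : ι → Sect1Inst` of first-step situations
(Sect. 1 data `D : B14.Sect1Repr.Sect1Data`, (1.8)–(1.11) geometry `X : B14.Eq111Resummation.Geom D`, averagings `av`, couplings
`g₀`, `g₁`) over which print's constants are uniform, with the distinguished index `i0` of the carriers' OWN situation (its
projections `X.D1`, `X.X1`, `X.av`, `X.g₀`, `X.g₁`), the renormalization transformations (0.1) `T k` of every step (inhabited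
carrier `Setup.RTOpI` over `X.av k`), the Wilson start's `E` (p. 243), the determining bonds `vars4` of (1.2), the printed
letters `ε₀, ε₁, z` of (1.6), `A₁, p₀` of the thresholds, the family `fam15` of variational problems (1.12) as instances of [15]
Theorem 1, the bond terms `v252` of V^{(0)}(S₁, ·), and the boundary term `B253` with its `O(1)` and volume token.  `Hyp V X` — the section's printed STATEMENTS as hypotheses BY NAME: `r244` = `DagBinding.ROpLeaf V`
(p. 244), `thm245` = `B14.ThmP245PrintedI` for the sequence (0.2) `B14.Eq02Iterate.rho X.T V.R ρ₀` (p. 245, literal sequence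
reading; `Hyp.ofSpacesI` takes the p. 262 space reading instead), `dep12` = `B14.Sect1Repr.U1locDependsOn` (p. 246), `eq16` =
`B14.Sect1Repr.Eq16` for `(X.T 0).T` (1.6), `adm110` = `B14.Eq111Resummation.Geom.Adm110` ((1.10) p. 248), `drop248`,
`thm1_15` = `B11.Thm1Printed X.fam15` (p. 248 «By Theorem 1 [15] …»), `smallS1`, `bdry253` — keyed to the consumer:
`Hyp.rOpLeaf` IS the DAG's `rOperation` leaf of node n11 (K1⁷ `stmt-QuantumFields-20542`), `Hyp.rAssumed` its printed
unfolding, `Hyp.firstStep` the `k = 0` instance of the p. 245 Theorem (= Sect. 1's conclusion (1.28)–(1.30) in the typed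
reading), `Hyp.inSpace_all` the induction (0.2) ⇒ «ρ_k satisfies the inductive assumptions for every k ≦ K» given the start
(`B14.inductiveAssumptions_of_thmP245I`), `Hyp.mapsSpaces_of_spacesI` the p. 262 remark through `DagBinding.ROpLeaf.mapsSpaces_of_thmP245SpacesI`,
`Hyp.isRT_eq111` = (1.11) with the block's own drop sentence and (1.10) inclusions supplied from the bundle.

## HONEST SCOPE
Nothing of [III] is proved here beyond finite-sum bookkeeping and three lines of real arithmetic; the p. 245 Theorem, the
assumed 𝐑, (1.6) for a general `T`, the drop sentence, [15] Theorem 1, the smallness of V^{(0)}(S₁) and the boundary-term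
bound are HYPOTHESIS SLOTS (members of `Hyp`), exactly as the DAG leaf `DagBinding.ROpLeaf` is; the residual sentences are
typed in the currency of the existing leaves (`B14.Eq111Resummation` for p. 248; schematic reals for p. 252 / p. 253), not
re-derived; no summit statement is proved by this seat; count-neutral; nothing continuum ∕ ℝ⁴ ∕ OS ∕ mass-gap ∕ Clay.  No
`sorry`, no `instance`, no `notation`.
-/

noncomputable section

namespace Literature.MathematicalPhysics.QuantumFieldTheory.Balaban1983to89.B14Carve33Sects01Hyp

open MeasureTheory
open DagBinding (PrintedCarriers14R ROpLeaf)
open B14.Sect1Repr (Sect1Data U1loc U1locDependsOn chi0 chi1 chi1c chiAx Eq16 rho0 integrand16 rho1Rhs)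
open B14.Sect3Decomp (chiPrime chiPrimec)
open B14.Eq111Resummation (Geom adm omegaOf admOmega dropped term zeta front sect3Zero)

/-! ## §1  Residual printed sentences of pp. 248, 252, 253 (hypothesis form) -/

section Drop

variable {P : Params} {G : Type*} [GaugeGroup G]

/-- **A first-step situation** — the data over which print's constants `A₀, A₁, p₀` are uniform (p. 246 l. 6 «A₀ is a
sufficiently large constant», fixed before the bare coupling is taken small): the Sect. 1 data `D` of (1.1)–(1.6) on top of
`Setup` (`B14.Sect1Repr.Sect1Data`: cube partitions, `(P₀′~)ᶜ`, `P₁¹`, contour variables, the ingredients of (1.2)), the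
(1.8)–(1.11) geometry `X` (`B14.Eq111Resummation.Geom`), the averaging operations `av`, the bare coupling `g₀` and the next
coupling `g₁` (p. 246 «ε₁ = g₁p₀(g₁)»).  Plain data, no instances. [cite: Balaban1988Convergent, (1.1)–(1.11) pp.246–248] -/
structure Sect1Inst (P : Params) (G : Type*) [GaugeGroup G] where
  D : Sect1Data P G
  X : Geom D
  av : ∀ j, Averaging P j G
  g₀ : ℝ
  g₁ : ℝ

/-- **p. 248, ll. 6–9 [PDF 6]** (`p0006.txt:L6–L9`), verbatim: «On the set Ω₁~ we have only the small field characteristic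
functions, and it is easy to see that the functions χ₀, χ_{Ax} localized in Ω₁~ are equal to 1, if A₀ is sufficiently larger
than A₁. We drop these functions from the integrals in (1.6).»  TYPED in the currency of `B14.Eq111Resummation` (where this
sentence is the binder `hdrop` of `term_eq` / `resum` / `isRT_eq111`), for a FAMILY `inst` of first-step situations (the
constants are printed uniform: «A₀ is a sufficiently large constant», p. 246; quantifier order as in `B11.Thm1Printed` /
`B14.Thm2Printed` — the threshold on `A₀` BEFORE the situation index): ON THE DOMAIN OF INTEGRATION OF (1.6)·(1.8) — the
δ-function `δ(ŪV⁻¹)` puts `V = Ū = (av 0).avg U`, and the small-field functions of the term labelled `σ = (P₀, P₁, Q₁)` do not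
vanish: `χ₁(P₁ᶜ)(Ū) ≠ 0` ((1.4), threshold `ε₁L⁻²`, `ε₁ = g₁p₀(g₁) = g₁A₀(log g₁⁻²)^{p₀}`, p. 246 l. 34) and `χ₀′(Q₁ᶜ)(U, Ū) ≠ 0`
((1.8), threshold `2δ₀`, `δ₀ = g₀A₁(log g₀⁻²)^{p₀} = (A₁/A₀)ε₀`, p. 247 ll. 36–37) — the dropped factor
`χ₀(□(Ω₁~))(U)·χ_{Ax}((Ω₁~)^{(1)})(U)` (`B14.Eq111Resummation.dropped`, threshold `ε₀ = g₀p₀(g₀) = g₀A₀(log g₀⁻²)^{p₀}`, p. 246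
ll. 5–6, for both functions, as in (1.1) and (1.5)) EQUALS `1`; «if A₀ is sufficiently larger than A₁» = a threshold `a₀` on `A₀`
at fixed `A₁`, uniform over the family.  Hypothesis only («it is easy to see» — not re-derived here; the set-level half of the
sentence is `B14Sect1Sets.enl_omega1_subset`). [cite: Balaban1988Convergent, p.248 ll.6–9] -/
def Drop248Printed {ι : Type*} (inst : ι → Sect1Inst P G) (A₁ : ℝ) (p₀ : ℕ) : Prop :=
  ∃ a₀ : ℝ, 0 < a₀ ∧ ∀ A₀ : ℝ, a₀ ≤ A₀ → ∀ i : ι,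
    ∀ σ ∈ adm (inst i).D (inst i).X, ∀ U : GaugeField P 0 G,
      chi1 (inst i).D ((inst i).g₁ * p0Profile A₀ p₀ (inst i).g₁) ((inst i).D.inCompl σ.1 \ σ.2.1)
          (((inst i).av 0).avg U) ≠ 0 →
      chiPrime (sect3Zero (inst i).D (inst i).X.bondsStar) (inst i).av
          (2 * ((inst i).g₀ * p0Profile A₁ p₀ (inst i).g₀)) ((inst i).X.domQ σ.1 σ.2.1 \ σ.2.2) U
          (((inst i).av 0).avg U) ≠ 0 →
      dropped (inst i).D (inst i).X ((inst i).g₀ * p0Profile A₀ p₀ (inst i).g₀) (omegaOf (inst i).D (inst i).X σ) U = 1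

omit [GaugeGroup G] in
/-- p. 247 ll. 36–37 «δ₀ = g₀A₁p₀(g₀) = (A₁/A₀)ε₀»: the (1.8) threshold used in `Drop248Printed`, `2δ₀` with
`δ₀ = g₀A₁(log g₀⁻²)^{p₀}`, IS `2·(A₁/A₀)ε₀` for `ε₀ = g₀A₀(log g₀⁻²)^{p₀}` (`A₀ ≠ 0`; the tree's `Setup.deltaK` reads δ the second
way).  Real arithmetic. [cite: Balaban1988Convergent, p.247 ll.36–37] -/
theorem two_delta0_eq {g₀ A₀ A₁ : ℝ} (p₀ : ℕ) (hA₀ : A₀ ≠ 0) :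
    2 * (g₀ * p0Profile A₁ p₀ g₀) = 2 * ((A₁ / A₀) * (g₀ * p0Profile A₀ p₀ g₀)) := by
  unfold p0Profile
  rw [div_mul_eq_mul_div, ← mul_div_assoc, eq_div_iff hA₀]
  ring

/-- The drop sentence delivers, for every `A₀` above the threshold and every situation of the family, the binder `hdrop` of
`B14.Eq111Resummation.resum` / `term_eq` at the point `(U, Ū)` of the domain of integration. Bookkeeping. [cite: Balaban1988Convergent, p.248 ll.6–9] -/
theorem Drop248Printed.hdrop {ι : Type*} {inst : ι → Sect1Inst P G} {A₁ : ℝ} {p₀ : ℕ}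
    (h : Drop248Printed inst A₁ p₀) :
    ∃ a₀ : ℝ, 0 < a₀ ∧ ∀ A₀ : ℝ, a₀ ≤ A₀ → ∀ (i : ι) (U : GaugeField P 0 G),
      ∀ σ ∈ adm (inst i).D (inst i).X,
        chi1 (inst i).D ((inst i).g₁ * p0Profile A₀ p₀ (inst i).g₁) ((inst i).D.inCompl σ.1 \ σ.2.1)
            (((inst i).av 0).avg U) ≠ 0 →
        chiPrime (sect3Zero (inst i).D (inst i).X.bondsStar) (inst i).av
            (2 * ((inst i).g₀ * p0Profile A₁ p₀ (inst i).g₀)) ((inst i).X.domQ σ.1 σ.2.1 \ σ.2.2) U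
            (((inst i).av 0).avg U) ≠ 0 →
        dropped (inst i).D (inst i).X ((inst i).g₀ * p0Profile A₀ p₀ (inst i).g₀)
          (omegaOf (inst i).D (inst i).X σ) U = 1 := by
  obtain ⟨a₀, ha₀, hA⟩ := h
  exact ⟨a₀, ha₀, fun A₀ hA₀ i U σ hσ => hA A₀ hA₀ i σ hσ U⟩

/-- **The resummation (1.11) at a point of the domain of integration, with NO drop binder left**: under the (1.10) inclusions
(`Geom.Adm110`) of a situation `i` and the p. 248 drop sentence, for every `A₀` above the threshold and every fine
configuration `U`, the terms of (1.6)·(1.8) at `(U, Ū)` regroup fibre by fibre of the (1.10) rule into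
`Σ_{Ω₁} χ₁(Ω₁)(Ū) · ζ(Ω₁ᶜ)(U,Ū) · χ₀′(Ω₁) exp[…](U,Ū)` (`B14.Eq111Resummation.resum`, by name) — thresholds
`ε₀ = g₀A₀(log g₀⁻²)^{p₀}`, `ε₁ = g₁A₀(log g₁⁻²)^{p₀}`, `2δ₀`. [cite: Balaban1988Convergent, (1.11) p.248] -/
theorem Drop248Printed.resum {ι : Type*} {inst : ι → Sect1Inst P G} {A₁ : ℝ} {p₀ : ℕ}
    (h : Drop248Printed inst A₁ p₀) (i : ι) (hX : B14.Eq111Resummation.Geom.Adm110 (inst i).D (inst i).X) (z E : ℝ) :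
    ∃ a₀ : ℝ, 0 < a₀ ∧ ∀ A₀ : ℝ, a₀ ≤ A₀ → ∀ U : GaugeField P 0 G,
      ∑ σ ∈ adm (inst i).D (inst i).X, term (inst i).D (inst i).X (inst i).av (inst i).g₀
          ((inst i).g₀ * p0Profile A₀ p₀ (inst i).g₀) ((inst i).g₁ * p0Profile A₀ p₀ (inst i).g₁)
          (2 * ((inst i).g₀ * p0Profile A₁ p₀ (inst i).g₀)) z E σ U (((inst i).av 0).avg U) =
        ∑ Ω ∈ admOmega (inst i).D (inst i).X,
          chi1 (inst i).D ((inst i).g₁ * p0Profile A₀ p₀ (inst i).g₁) Ω (((inst i).av 0).avg U) *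
          (zeta (inst i).D (inst i).X (inst i).av (inst i).g₀ ((inst i).g₀ * p0Profile A₀ p₀ (inst i).g₀)
              ((inst i).g₁ * p0Profile A₀ p₀ (inst i).g₁) (2 * ((inst i).g₀ * p0Profile A₁ p₀ (inst i).g₀)) z Ω U
              (((inst i).av 0).avg U) *
            front (inst i).D (inst i).X (inst i).av (inst i).g₀ (2 * ((inst i).g₀ * p0Profile A₁ p₀ (inst i).g₀))
              z E Ω U (((inst i).av 0).avg U)) := by
  obtain ⟨a₀, ha₀, hA⟩ := h.hdrop
  refine ⟨a₀, ha₀, fun A₀ hA₀ U => ?_⟩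
  exact B14.Eq111Resummation.resum (inst i).D (inst i).X (inst i).av hX (inst i).g₀ _ _ _ z E U
    (((inst i).av 0).avg U) (hA A₀ hA₀ i U)

/-- **(1.11) in the push-forward reading of `∫dU δ(ŪV⁻¹)`, with NO drop binder left** (the statement of
`B14.Eq111Resummation.isRT_eq111` with its `hdrop` supplied by the printed sentence, which lives exactly on the domain of
integration `V = Ū`): for a situation `i` of the family, under the hypotheses of `B14Eq16Proof.isRT_eq16` (gauge-covariant
measurable averaging, measurable `U_{1,□′}(·)` and `U(y,x)`, `g₀ ≠ 0`, `z = z(g₀², ε₀) ≠ 0`, `d = 4`, `1 ≦ m + K`), the (1.10)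
inclusions and the drop sentence, for every `A₀` above the threshold: if `ρ₁` is the renormalization image of `ρ₀ =
exp[−(1/g₀²)A − E]` then `ρ₁` is the renormalization image of the (1.11) density `U ↦ Σ_{Ω₁} χ₁(Ω₁)(Ū) ζ(Ω₁ᶜ)(U,Ū) χ₀′(Ω₁)(U,Ū)
exp[−(1/g₀²)𝐆(Ω₁^{(1)},U) − (1/g₀²)A(U) − (L⁴−1)|Ω₁^{(1)}| log z − E]`.  PROOF = p28's (1.6) in this reading, (1.8) inserted
(`sum16_mul18`), `resum`. [cite: Balaban1988Convergent, (1.11) p.248] -/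
theorem Drop248Printed.isRT_eq111 [MeasurableSpace G] [HaarData G] [RegularGaugeGroup G] {ι : Type*}
    {inst : ι → Sect1Inst P G} {A₁ : ℝ} {p₀ : ℕ} (h : Drop248Printed inst A₁ p₀) (i : ι) (hd : P.d = 4)
    (h01 : 0 + 1 ≤ P.m + P.K) (hX : B14.Eq111Resummation.Geom.Adm110 (inst i).D (inst i).X)
    (hav : Measurable ((inst i).av 0).avg) (hU1 : ∀ c, Measurable (U1loc (inst i).D c))
    (hcd : ∀ (y : Site P 1) (x : Site P 0), Measurable fun U : GaugeField P 0 G => (inst i).D.cd.holTo U y x)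
    (hg₀ : (inst i).g₀ ≠ 0) (E : ℝ) :
    ∃ a₀ : ℝ, 0 < a₀ ∧ ∀ A₀ : ℝ, a₀ ≤ A₀ →
      B16ZLower.zNorm G ((inst i).g₀ ^ 2) ((inst i).g₀ * p0Profile A₀ p₀ (inst i).g₀) ≠ 0 →
      ∀ {ρ₁ : Density P 1 G}, IsRT ((inst i).av 0).avg (rho0 (inst i).g₀ E) ρ₁ →
        IsRT ((inst i).av 0).avg (fun U => ∑ Ω ∈ admOmega (inst i).D (inst i).X,
          chi1 (inst i).D ((inst i).g₁ * p0Profile A₀ p₀ (inst i).g₁) Ω (((inst i).av 0).avg U) *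
          (zeta (inst i).D (inst i).X (inst i).av (inst i).g₀ ((inst i).g₀ * p0Profile A₀ p₀ (inst i).g₀)
              ((inst i).g₁ * p0Profile A₀ p₀ (inst i).g₁) (2 * ((inst i).g₀ * p0Profile A₁ p₀ (inst i).g₀))
              (B16ZLower.zNorm G ((inst i).g₀ ^ 2) ((inst i).g₀ * p0Profile A₀ p₀ (inst i).g₀)) Ω U
              (((inst i).av 0).avg U) *
            (chiPrime (sect3Zero (inst i).D (inst i).X.bondsStar) (inst i).av
                (2 * ((inst i).g₀ * p0Profile A₁ p₀ (inst i).g₀)) Ω U (((inst i).av 0).avg U) *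
              Real.exp (-(1 / (inst i).g₀ ^ 2) * gaugeFixFn (inst i).D.cd ((inst i).X.sites1 Ω) U
                - (1 / (inst i).g₀ ^ 2) * wilsonAction4 U
                - ((P.L : ℝ) ^ 4 - 1) * (((inst i).X.sites1 Ω).card : ℝ) *
                    Real.log (B16ZLower.zNorm G ((inst i).g₀ ^ 2) ((inst i).g₀ * p0Profile A₀ p₀ (inst i).g₀)) - E))))
          ρ₁ := by
  obtain ⟨a₀, ha₀, hA⟩ := h.hdrop
  refine ⟨a₀, ha₀, fun A₀ hA₀ hz ρ₁ hρ₁ => ?_⟩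
  set D := (inst i).D
  set X := (inst i).X
  set av := (inst i).av
  set g₀ := (inst i).g₀
  set g₁ := (inst i).g₁
  set ε₀ : ℝ := g₀ * p0Profile A₀ p₀ g₀
  set ε₁ : ℝ := g₁ * p0Profile A₀ p₀ g₁
  set twoδ : ℝ := 2 * (g₀ * p0Profile A₁ p₀ g₀)
  have h16 := B14Eq16Proof.isRT_eq16 hd h01 D (av 0) hav hU1 hcd hg₀ hz ε₁ E hρ₁
  have hF : (fun U => ∑ P0 ∈ (Finset.univ : Finset D.Cube0).powerset, ∑ P1 ∈ (D.inCompl P0).powerset,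
      chi1c D ε₁ P1 ((av 0).avg U) * chi1 D ε₁ (D.inCompl P0 \ P1) ((av 0).avg U) *
        integrand16 D g₀ ε₀ (B16ZLower.zNorm G (g₀ ^ 2) ε₀) E P0 P1 U) =
      fun U => ∑ Ω ∈ admOmega D X, chi1 D ε₁ Ω ((av 0).avg U) *
        (zeta D X av g₀ ε₀ ε₁ twoδ (B16ZLower.zNorm G (g₀ ^ 2) ε₀) Ω U ((av 0).avg U) *
          (chiPrime (sect3Zero D X.bondsStar) av twoδ Ω U ((av 0).avg U) *
            Real.exp (-(1 / g₀ ^ 2) * gaugeFixFn D.cd (X.sites1 Ω) U - (1 / g₀ ^ 2) * wilsonAction4 U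
              - ((P.L : ℝ) ^ 4 - 1) * ((X.sites1 Ω).card : ℝ) * Real.log (B16ZLower.zNorm G (g₀ ^ 2) ε₀) - E))) := by
    funext U
    rw [B14.Eq111Resummation.sum16_mul18 D X av g₀ ε₀ ε₁ twoδ (B16ZLower.zNorm G (g₀ ^ 2) ε₀) E U ((av 0).avg U),
      B14.Eq111Resummation.resum D X av hX g₀ ε₀ ε₁ twoδ (B16ZLower.zNorm G (g₀ ^ 2) ε₀) E U ((av 0).avg U)
        (hA A₀ hA₀ i U)]
    rfl
  rw [hF] at h16
  exact h16

end Drop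

/-- **p. 252, ll. 25–30 [PDF 10]** (`p0010.txt:L25–L30`; render crop read as image), verbatim: «Expanding the terms of the
effective action in the second exponential in (1.15) with respect to the last two perturbative terms in (1.22) up to the first
order, we obtain a new expression V^{(0)}(S₁, A, 𝐇_{1,Ax}). Because of the almost local character of the action in (1.15), it is a
sum over bonds b ∈ S₁ of the expressions which depend on A, 𝐇_{1,Ax} almost locally. The dependence on 𝐇_{1,Ax} is analytic, and
the expressions are small, i.e., they can be bounded by any positive power of g₀.»  TYPED (schematic, the smallness clause
only): `S1` = the bonds of `S₁`, `Arg` = the arguments `(A, 𝐇_{1,Ax})` in their domain, `v g₀ b x` = the bond expression at bare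
coupling `g₀` (every object of the first step is a function of `g₀`); «bounded by any positive power of g₀» READ AS: for every
power `N ≧ 1` there is a threshold on `g₀` below which `|v g₀ b x| ≦ g₀^N` for all bonds and arguments (print's O(1) factors are
absorbed by the threshold: `C g₀^{N+1} ≦ g₀^N` once `g₀ ≦ 1/C`; the §3 twin with the O(1) displayed is
`B14Eq322Analytic.norm_bH_le_pow`).  «almost locally» and «analytic» have no second object here and are NOT typed.  Hypothesis
only. [cite: Balaban1988Convergent, p.252 ll.25–30] -/
def SmallS1Terms252Printed {S1 Arg : Type*} (v : ℝ → S1 → Arg → ℝ) : Prop :=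
  ∀ N : ℕ, 1 ≤ N → ∃ c : ℝ, 0 < c ∧ ∀ g₀ : ℝ, 0 < g₀ → g₀ ≤ c → ∀ (b : S1) (x : Arg), |v g₀ b x| ≤ g₀ ^ N

/-- A bound by the power `N` is a bound by every power `M ≦ N` on `0 < g₀ ≦ 1` (so the reading is monotone in the power; the
threshold for `M` may be taken `min c 1`). Real arithmetic. [cite: Balaban1988Convergent, p.252 ll.25–30] -/
theorem smallS1Terms252_mono {S1 Arg : Type*} {v : ℝ → S1 → Arg → ℝ} (h : SmallS1Terms252Printed v) {M N : ℕ}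
    (hM : 1 ≤ M) (hMN : M ≤ N) :
    ∃ c : ℝ, 0 < c ∧ ∀ g₀ : ℝ, 0 < g₀ → g₀ ≤ c → ∀ (b : S1) (x : Arg), |v g₀ b x| ≤ g₀ ^ M := by
  obtain ⟨c, hc, hb⟩ := h N (le_trans hM hMN)
  refine ⟨min c 1, lt_min hc one_pos, fun g₀ hg₀ hg b x => ?_⟩
  have hgc : g₀ ≤ c := le_trans hg (min_le_left _ _)
  have hg1 : g₀ ≤ 1 := le_trans hg (min_le_right _ _)
  exact le_trans (hb g₀ hg₀ hgc b x) (pow_le_pow_of_le_one hg₀.le hg1 hMN)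

/-- **p. 253, ll. 12–15 [PDF 11]** (`p0011.txt:L12–L15`; render crop `…-p011-x2.png` read as image), verbatim: «we denote the
sum of these terms, and the expanded V^{(0)}(S₁), by 𝐁^{(1)}(U₁, Λ₁ᶜA, S₁). This is the boundary term, and it can be bounded by
O(1)|Λ₁∩Λ₁ᶜ|; therefore it is controlled by the large field estimates, and does not need to be renormalized.»  TYPED AS PRINTED
(schematic reals): `B` = the value of the boundary term `𝐁^{(1)}(U₁, Λ₁ᶜA, S₁)` at one argument, `C` = the `O(1)`, `vol` = the
printed volume factor.  Print's token «|Λ₁∩Λ₁ᶜ|» [sic] is the number of points of `Λ₁ ∩ Λ₁ᶜ = ∅`, i.e. `0`; which neighbouring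
set is meant (the terms live «within the distance MR₁ to Λ₁ᶜ», ll. 11–12; (1.30) multiplies them by `χ(Ω₁∩Λ₁ᶜ, S₁)`) is NOT
decided here — `vol` is a PARAMETER, and `boundaryTerm253_literal` records what the literal token gives.  The general §2 bound
of the boundary terms is the decay clause (2.42) `Step.LFHyp.boundB` (another shape).  Hypothesis only. [cite: Balaban1988Convergent, p.253 ll.12–15] -/
def BoundaryTerm253Printed (B C vol : ℝ) : Prop :=
  |B| ≤ C * vol

/-- THE LITERAL TOKEN COLLAPSES: if the volume factor is read literally as `|Λ₁ ∩ Λ₁ᶜ|` — the cardinality of the intersection of a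
finite set of sites with its complement — then the printed bound forces `𝐁^{(1)} = 0` (for any `O(1)`).  Kernel-checked record of
the print defect; no reading is asserted. [cite: Balaban1988Convergent, p.253 ll.12–15] -/
theorem boundaryTerm253_literal {α : Type*} [Fintype α] [DecidableEq α] (Λ₁ : Finset α) {B C : ℝ}
    (h : BoundaryTerm253Printed B C ((Λ₁ ∩ Λ₁ᶜ).card : ℝ)) : B = 0 := by
  have h0 : (Λ₁ ∩ Λ₁ᶜ).card = 0 := by
    rw [Finset.card_eq_zero, Finset.inter_compl]
  unfold BoundaryTerm253Printed at h
  rw [h0, Nat.cast_zero, mul_zero] at h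
  exact abs_nonpos_iff.mp h

/-- Conversely the literal reading is satisfied by `𝐁^{(1)} = 0` only, and by it (consistency of the record of the printed
token). [cite: Balaban1988Convergent, p.253 ll.12–15] -/
theorem boundaryTerm253_literal_iff {α : Type*} [Fintype α] [DecidableEq α] (Λ₁ : Finset α) (B C : ℝ) :
    BoundaryTerm253Printed B C ((Λ₁ ∩ Λ₁ᶜ).card : ℝ) ↔ B = 0 := by
  refine ⟨boundaryTerm253_literal Λ₁, fun hB => ?_⟩
  subst hB
  simp [BoundaryTerm253Printed, Finset.inter_compl]

/-- Under any reading with a non-negative `O(1)` and volume, the printed bound is a genuine (possibly vacuous) inequality: it holds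
for `𝐁^{(1)} = 0`. Satisfiability witness for the typed p. 253 sentence. [cite: Balaban1988Convergent, p.253 ll.12–15] -/
theorem boundaryTerm253_zero {C vol : ℝ} (hC : 0 ≤ C) (hvol : 0 ≤ vol) : BoundaryTerm253Printed 0 C vol := by
  unfold BoundaryTerm253Printed
  rw [abs_zero]
  exact mul_nonneg hC hvol

/-! ## §2  The bundle: the printed statements of pp. 243–254 as hypotheses, by name, keyed to `DagBinding.ROpLeaf` -/

/-- **Carriers of the block-33 bundle** beyond the DAG record `V : DagBinding.PrintedCarriers14R` (which carries the lattice
parameters `V.P`, the gauge group `V.G` with its `Setup` instances, the number of steps `V.K`, the assumed operations `V.R k` =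
𝐑 on the densities of `T^{(k+1)}`, and the two families of spaces `V.S k` = «the assumptions described in detail in Sect. 2» with
index k, `V.Scorr (k+1)` = «the corresponding assumptions» for a T-image) — one field per parameter of the section's other
printed statements, plain data: Sect. 1 — the family `inst : ι → Sect1Inst V.P V.G` of first-step situations over which print's
constants `A₀, A₁, p₀` are uniform (each: the data `D` of (1.1)–(1.6) on top of `Setup` = `B14.Sect1Repr.Sect1Data` — the two cube
partitions, `P₀ ↦ (P₀′~)ᶜ`, `P₁¹`, the contour variables, the ingredients of (1.2) —, the (1.8)–(1.11) geometry `X` =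
`B14.Eq111Resummation.Geom D` — `(□′~²)*`, the range of `Q₁`, the (1.10) rule `Ω₁`, `Ω₁^{(1)}`, `□(Ω₁~)`, `(Ω₁~)^{(1)}` —, the
averaging operations `av j` of (0.1), the bare coupling `g₀` of the Wilson start p. 243 «ρ₀ = exp[−(1/g₀²)A − E]» and the next
coupling `g₁` of p. 246 «ε₁ = g₁p₀(g₁)») and the distinguished index `i0` of the carriers' OWN situation; (0.1)/(0.2) — the
renormalization transformations `T k` of every step (operators in the inhabited carrier `Setup.RTOpI` over the own averagings) and
the normalization constant `E`; the determining bonds `vars4 □′` = the bonds of `□′~⁴` in `T^{(1)}` (p. 246 l. 28); the printed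
letters `ε₀`, `ε₁`, `z` of (1.6) (p. 246 «ε₀ = g₀p₀(g₀)»; `z` the one-bond normalization of (1.5)), the constant `A₁` and the
exponent `p₀` of the thresholds (p. 246 l. 6, p. 247 l. 36); p. 248 — the index type `I15` and the family `fam15` of the
variational problems (1.12) (one per `Ω₁`, `V₀`, torus) as instances of the setting of [15] Theorem 1 (`B11.VarProblem`);
p. 252 — the bonds `S1` of `S₁`, the arguments `Arg252` of the bond terms of V^{(0)}(S₁, A, 𝐇_{1,Ax}) and the terms `v252`;
p. 253 — the arguments `Cfg253` of the boundary term `𝐁^{(1)}(U₁, Λ₁ᶜA, S₁)`, its values `B253`, the `O(1)` `C253` and the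
volume token `vol253`. [cite: Balaban1988Convergent, (0.1)–(0.2) pp.243–244, (1.1)–(1.30) pp.246–254] -/
structure Carriers (V : PrintedCarriers14R) where
  ι : Type
  inst : ι → Sect1Inst V.P V.G
  i0 : ι
  T : ∀ k, RTOpI V.P k V.G ((inst i0).av k)
  E : ℝ
  vars4 : (inst i0).D.Cube1 → Set (PBond V.P 1)
  ε₀ : ℝ
  ε₁ : ℝ
  z : ℝ
  A₁ : ℝ
  p₀ : ℕ
  I15 : Type
  fam15 : I15 → B11.VarProblem
  S1 : Type
  Arg252 : Type
  v252 : ℝ → S1 → Arg252 → ℝ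
  Cfg253 : Type
  B253 : Cfg253 → ℝ
  C253 : ℝ
  vol253 : ℝ

/-- The carriers' OWN first-step situation: the distinguished member `inst i0` of the family. [cite: Balaban1988Convergent, (1.1)–(1.11) pp.246–248] -/
abbrev Carriers.sit {V : PrintedCarriers14R} (X : Carriers V) : Sect1Inst V.P V.G :=
  X.inst X.i0

/-- The Sect. 1 data `D` of the carriers' own situation. [cite: Balaban1988Convergent, (1.1)–(1.4) p.246] -/
abbrev Carriers.D1 {V : PrintedCarriers14R} (X : Carriers V) : Sect1Data V.P V.G :=
  X.sit.D

/-- The (1.8)–(1.11) geometry of the carriers' own situation. [cite: Balaban1988Convergent, (1.8)–(1.10) pp.247–248] -/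
abbrev Carriers.X1 {V : PrintedCarriers14R} (X : Carriers V) : Geom X.D1 :=
  X.sit.X

/-- The averaging operations of the carriers' own situation. [cite: Balaban1988Convergent, (0.1) p.243] -/
abbrev Carriers.av {V : PrintedCarriers14R} (X : Carriers V) : ∀ j, Averaging V.P j V.G :=
  X.sit.av

/-- The bare coupling `g₀` of the carriers' own situation (p. 243 «ρ₀ = exp[−(1/g₀²)A − E]»). [cite: Balaban1988Convergent, (0.2) p.244] -/
abbrev Carriers.g₀ {V : PrintedCarriers14R} (X : Carriers V) : ℝ :=
  X.sit.g₀

/-- The next coupling `g₁` of the carriers' own situation (p. 246 «ε₁ = g₁p₀(g₁)»). [cite: Balaban1988Convergent, (1.4) p.246] -/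
abbrev Carriers.g₁ {V : PrintedCarriers14R} (X : Carriers V) : ℝ :=
  X.sit.g₁

/-- The Wilson start `ρ₀ = exp[−(1/g₀²)A − E]` of the bundle's carriers (p. 243; `B14.Sect1Repr.rho0`). [cite: Balaban1988Convergent, (0.2) p.244] -/
abbrev Carriers.ρ₀ {V : PrintedCarriers14R} (X : Carriers V) : Density V.P 0 V.G :=
  rho0 X.g₀ X.E

/-- The sequence (0.2) `ρ_k = (𝐑T)^kρ₀` of the bundle's carriers, with the DAG record's own operations 𝐑 (`V.R`) and the
carriers' transformations `T` and start `ρ₀` (`B14.Eq02Iterate.rho`, by name). [cite: Balaban1988Convergent, (0.2) p.244] -/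
abbrev Carriers.ρ {V : PrintedCarriers14R} (X : Carriers V) : (k : ℕ) → Density V.P k V.G :=
  B14.Eq02Iterate.rho X.T V.R X.ρ₀

/-- The same sequence as a trajectory of the inhabited step carrier `Step.DensityRGI` (`B14.Eq02Iterate.densityRGI`), whose
large-field operations ARE the DAG record's `V.R` (so the identification `hR` of `DagBinding.ROpLeaf.mapsSpacesI` is `rfl`).
[cite: Balaban1988Convergent, (0.2) p.244] -/
abbrev Carriers.traj {V : PrintedCarriers14R} (X : Carriers V) : Step.DensityRGI V.P V.G X.av :=
  B14.Eq02Iterate.densityRGI X.T V.R X.ρ₀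

/-- **BLOCK 33 BUNDLE — the printed statements of [Balaban1988Convergent] pp. 243–254 AS HYPOTHESES, BY NAME.**  One field per
statement, each a reference to the declaration of record typing it (nothing restated): `r244` — p. 244 «The operation 𝐑 serves
this purpose. We will not describe it here, we will only assume that it has some properties incorporated in the inductive
description of the effective actions» (`DagBinding.ROpLeaf V` = `B14.RAssumedP244 V.R V.Scorr V.S V.K`, the DAG's `rOperation`
leaf); `thm245` — THEOREM p. 245 «If ρ_k satisfies the assumptions described in detail in Sect. 2, then Tρ_k satisfies also the
corresponding assumptions» for the sequence (0.2) of the carriers (`B14.ThmP245PrintedI`, sequence reading; the p. 262 space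
reading implies it, `Hyp.ofSpacesI`); `dep12` — p. 246 «The function in (1.2) depends on the field V restricted to □′~⁴»
(`B14.Sect1Repr.U1locDependsOn`); `eq16` — (1.6) p. 247 «This yields the equality ρ₁(V) = Σ_{P₀P₁} χ₁ᶜ(P₁)χ₁(P₁ᶜ) ∫dU δ(ŪV⁻¹)
χ₀ᶜ(P₀)χ₀(P₀ᶜ)χ_{Ax}(P₁¹) exp[…]» for the first transformation `(X.T 0).T` at the printed letters `ε₀, ε₁, z, E`
(`B14.Sect1Repr.Eq16`); `adm110` — (1.10) p. 248 «Ω₁ is a union of LMR₁-cubes, and a distance between Ω₁ and the union of the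
large field regions is at least 2LMR₁. On the set Ω₁~ we have only the small field characteristic functions», as the cube-family
inclusions the resummation uses (`B14.Eq111Resummation.Geom.Adm110`); `drop248` — p. 248 «the functions χ₀, χ_{Ax} localized in
Ω₁~ are equal to 1, if A₀ is sufficiently larger than A₁» (`Drop248Printed`, this file); `thm1_15` — p. 248 «By Theorem 1 [15]
there exists exactly one critical point of (1.12) in the domain of integration in (1.11), for ε₀ sufficiently small. It is a
minimum of (1.12), with a strictly positive second order differential»: the cited theorem BY NAME, [15] Theorem 1 for the
family of variational problems (1.12) (`B11.Thm1Printed X.fam15`; the (1.12) objects are `B14.Eq112Variational.argmin112` /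
`argminAx`, existence not asserted there); `smallS1` — p. 252 «the expressions are small, i.e., they can be bounded by any positive
power of g₀» (`SmallS1Terms252Printed`); `bdry253` — p. 253 «This is the boundary term, and it can be bounded by O(1)|Λ₁∩Λ₁ᶜ|»
(`BoundaryTerm253Printed`, volume token a parameter).  Hypothesis slot only; `r244` is literally the DAG leaf `rOperation` of
node n11 [B14] consumed by K1⁷ (`stmt-QuantumFields-20542`). [cite: Balaban1988Convergent, p.244, Theorem p.245, (1.2) p.246, (1.6) p.247, (1.10)–(1.12) p.248, p.252, p.253] -/
structure Hyp (V : PrintedCarriers14R) (X : Carriers V) : Prop where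
  r244 : ROpLeaf V
  thm245 : B14.ThmP245PrintedI X.T X.ρ V.S V.Scorr V.K
  dep12 : U1locDependsOn X.D1 X.vars4
  eq16 : Eq16 X.D1 (X.T 0).T X.g₀ X.ε₀ X.ε₁ X.z X.E
  adm110 : B14.Eq111Resummation.Geom.Adm110 X.D1 X.X1
  drop248 : Drop248Printed X.inst X.A₁ X.p₀
  thm1_15 : B11.Thm1Printed X.fam15
  smallS1 : SmallS1Terms252Printed X.v252
  bdry253 : ∀ a : X.Cfg253, BoundaryTerm253Printed (X.B253 a) X.C253 X.vol253

variable {V : PrintedCarriers14R} {X : Carriers V}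

/-- **The consumer's form**: the bundle's `r244` IS the DAG's `rOperation` leaf `DagBinding.ROpLeaf V` of node n11 [B14] (the
leaf the K1⁷ binding `DagBinding.Upstream.ofPrintedAll … V …` consumes). Bookkeeping. [cite: Balaban1988Convergent, p.244] -/
theorem Hyp.rOpLeaf (h : Hyp V X) : ROpLeaf V :=
  h.r244

/-- The assumed property of 𝐑 unfolded by name (`DagBinding.rOpLeaf_iff`, `B14.RAssumedP244`): every operation `𝐑_k`, `k < K`,
takes a density satisfying «the corresponding assumptions» of a T-image to one satisfying the Sect. 2 assumptions with index
`k + 1`. [cite: Balaban1988Convergent, p.244] -/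
theorem Hyp.rAssumed (h : Hyp V X) :
    ∀ k, k < V.K → ∀ ρ' : Density V.P (k + 1) V.G, V.Scorr (k + 1) ρ' → V.S (k + 1) (V.R k ρ') :=
  (DagBinding.rOpLeaf_iff V).1 h.r244

/-- The same as B14's `RAssumedP244` for the trajectory's operations (definitionally the carrier's `V.R`). [cite: Balaban1988Convergent, p.244] -/
theorem Hyp.rAssumedP244 (h : Hyp V X) : B14.RAssumedP244 X.traj.R V.Scorr V.S V.K :=
  h.r244

/-- **Sect. 1's conclusion in the typed reading** — p. 254 ll. 17–19 «The representation (1.28)–(1.30) will be generalized in the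
next section to an inductive description of the k-th effective density»: the `k = 0` instance of the p. 245 Theorem — if the
Wilson start `ρ₀` satisfies the index-0 assumptions then `Tρ₀` satisfies the corresponding index-1 assumptions (whose content,
(1.28)–(1.30) = (2.18) at k = 1, is `Step.Repr218` / `B14Eq218SeqSucc.sum_seq_zero` / `B14.Def2Ek.Ek_one`).  Projection of
`thm245` at `k = 0`. [cite: Balaban1988Convergent, (1.28)–(1.30) pp.253–254, Theorem p.245] -/
theorem Hyp.firstStep (h : Hyp V X) (hK : 0 < V.K) (h0 : V.S 0 X.ρ₀) : V.Scorr 1 ((X.T 0).T X.ρ₀) :=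
  h.thm245 0 hK h0

/-- After the first step AND the (assumed) operation 𝐑₀: `ρ₁ = 𝐑₀T₀ρ₀` satisfies the Sect. 2 assumptions with index 1
((0.2) at k = 1; `B14.Eq02Iterate.rho_succ`). Bookkeeping. [cite: Balaban1988Convergent, (0.2) p.244, Theorem p.245] -/
theorem Hyp.firstStep_R (h : Hyp V X) (hK : 0 < V.K) (h0 : V.S 0 X.ρ₀) : V.S 1 (X.ρ 1) :=
  h.rAssumed 0 hK _ (h.firstStep hK h0)

/-- **THE INDUCTION ALONG (0.2)** (Thm 1 p. 262 ⇐ start + p. 245 Theorem + assumed 𝐑, `B14.inductiveAssumptions_of_thmP245I`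
by name): given the start `ρ₀` in the index-0 space, every `ρ_k = (𝐑T)^kρ₀`, `k ≦ K`, satisfies the Sect. 2 assumptions with
index k.  The start is a HYPOTHESIS (its content is the Wilson density, (2.18) with no terms). Pure logic. [cite: Balaban1988Convergent, Thm 1 p.262 with Theorem p.245, (0.2) p.244] -/
theorem Hyp.inSpace_all (h : Hyp V X) (h0 : V.S 0 X.ρ₀) : ∀ k, k ≤ V.K → V.S k (X.ρ k) :=
  B14.inductiveAssumptions_of_thmP245I (S := V.S) (Scorr := V.Scorr) (K := V.K) X.traj h0 h.thm245 h.r244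

/-- The bundle's `thm245` (sequence reading, the literal p. 245 sentence about `ρ_k`) from the p. 262 SPACE reading «the
operation 𝐑T transforms the space with the index k into the space with the index k+1» restricted to T
(`B14.ThmP245SpacesI`, `B14.thmP245PrintedI_of_spacesI`). Pure logic. [cite: Balaban1988Convergent, Theorem p.245 with remark p.262] -/
theorem thm245_of_spacesI (hS : B14.ThmP245SpacesI X.T V.S V.Scorr V.K) :
    B14.ThmP245PrintedI X.T X.ρ V.S V.Scorr V.K :=
  B14.thmP245PrintedI_of_spacesI hS X.ρ

/-- Constructor: the bundle from its members with the p. 245 Theorem given in the SPACE reading. Bookkeeping. [cite: Balaban1988Convergent, Theorem p.245 with remark p.262] -/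
theorem Hyp.ofSpacesI (r244 : ROpLeaf V) (hS : B14.ThmP245SpacesI X.T V.S V.Scorr V.K)
    (dep12 : U1locDependsOn X.D1 X.vars4) (eq16 : Eq16 X.D1 (X.T 0).T X.g₀ X.ε₀ X.ε₁ X.z X.E)
    (adm110 : B14.Eq111Resummation.Geom.Adm110 X.D1 X.X1) (drop248 : Drop248Printed X.inst X.A₁ X.p₀)
    (thm1_15 : B11.Thm1Printed X.fam15) (smallS1 : SmallS1Terms252Printed X.v252)
    (bdry253 : ∀ a : X.Cfg253, BoundaryTerm253Printed (X.B253 a) X.C253 X.vol253) : Hyp V X :=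
  ⟨r244, thm245_of_spacesI hS, dep12, eq16, adm110, drop248, thm1_15, smallS1, bdry253⟩

/-- With the p. 245 Theorem in the SPACE reading, the bundle's `r244` gives the p. 262 remark «the operation 𝐑T transforms the
space with the index k into the space with the index k+1» for the carriers' trajectory (`DagBinding.ROpLeaf.mapsSpaces_of_thmP245SpacesI`,
identification `hR` by `rfl`). Pure logic. [cite: Balaban1988Convergent, Theorem p.245 with remark p.262] -/
theorem Hyp.mapsSpaces_of_spacesI (h : Hyp V X) (hS : B14.ThmP245SpacesI X.T V.S V.Scorr V.K) :
    X.traj.MapsSpaces V.S V.K :=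
  DagBinding.ROpLeaf.mapsSpaces_of_thmP245SpacesI V X.traj (fun _ _ => rfl) hS h.r244

/-- p. 246 «The function in (1.2) depends on the field V restricted to □′~⁴», unfolded: two coarse fields agreeing on the bonds of
`□′~⁴` have the same localized background `U_{1,□′}`. [cite: Balaban1988Convergent, (1.2) p.246] -/
theorem Hyp.u1loc_local (h : Hyp V X) (c : X.D1.Cube1) (W W' : GaugeField V.P 1 V.G)
    (hWW' : ∀ b ∈ X.vars4 c, W b = W' b) : U1loc X.D1 c W = U1loc X.D1 c W' :=
  h.dep12 c W W' hWW'

/-- (1.6) out of the bundle, pointwise: `(T₀ρ₀)(V₁) = Σ_{P₀P₁} χ₁ᶜ(P₁)χ₁(P₁ᶜ) T₀[χ₀ᶜ(P₀)χ₀(P₀ᶜ)χ_{Ax}(P₁¹)e^{…}](V₁)`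
(`B14.Sect1Repr.rho1Rhs`). [cite: Balaban1988Convergent, (1.6) p.247] -/
theorem Hyp.eq16_at (h : Hyp V X) (V₁ : GaugeField V.P 1 V.G) :
    (X.T 0).T X.ρ₀ V₁ = rho1Rhs X.D1 (X.T 0).T X.g₀ X.ε₀ X.ε₁ X.z X.E V₁ :=
  h.eq16 V₁

/-- **(1.11) out of the bundle** (push-forward reading; the bundle supplies BOTH printed inputs of `B14.Eq111Resummation.isRT_eq111`
— the (1.10) inclusions `adm110` and the drop sentence `drop248` —, so that only the measure-theoretic side conditions of p28's
(1.6) remain): for every `A₀` above the drop threshold, if `ρ₁` is the renormalization image of `ρ₀` along `(X.av 0).avg` then it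
is the renormalization image of the (1.11) density. [cite: Balaban1988Convergent, (1.11) p.248] -/
theorem Hyp.isRT_eq111 [RegularGaugeGroup V.G] (h : Hyp V X) (hd : V.P.d = 4) (h01 : 0 + 1 ≤ V.P.m + V.P.K)
    (hav : Measurable (X.av 0).avg) (hU1 : ∀ c, Measurable (U1loc X.D1 c))
    (hcd : ∀ (y : Site V.P 1) (x : Site V.P 0), Measurable fun U : GaugeField V.P 0 V.G => X.D1.cd.holTo U y x)
    (hg₀ : X.g₀ ≠ 0) :
    ∃ a₀ : ℝ, 0 < a₀ ∧ ∀ A₀ : ℝ, a₀ ≤ A₀ →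
      B16ZLower.zNorm V.G (X.g₀ ^ 2) (X.g₀ * p0Profile A₀ X.p₀ X.g₀) ≠ 0 →
      ∀ {ρ₁ : Density V.P 1 V.G}, IsRT (X.av 0).avg X.ρ₀ ρ₁ →
        IsRT (X.av 0).avg (fun U => ∑ Ω ∈ admOmega X.D1 X.X1,
          chi1 X.D1 (X.g₁ * p0Profile A₀ X.p₀ X.g₁) Ω ((X.av 0).avg U) *
          (zeta X.D1 X.X1 X.av X.g₀ (X.g₀ * p0Profile A₀ X.p₀ X.g₀) (X.g₁ * p0Profile A₀ X.p₀ X.g₁)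
              (2 * (X.g₀ * p0Profile X.A₁ X.p₀ X.g₀))
              (B16ZLower.zNorm V.G (X.g₀ ^ 2) (X.g₀ * p0Profile A₀ X.p₀ X.g₀)) Ω U ((X.av 0).avg U) *
            (chiPrime (sect3Zero X.D1 X.X1.bondsStar) X.av (2 * (X.g₀ * p0Profile X.A₁ X.p₀ X.g₀)) Ω U
                ((X.av 0).avg U) *
              Real.exp (-(1 / X.g₀ ^ 2) * gaugeFixFn X.D1.cd (X.X1.sites1 Ω) U - (1 / X.g₀ ^ 2) * wilsonAction4 U
                - ((V.P.L : ℝ) ^ 4 - 1) * ((X.X1.sites1 Ω).card : ℝ) *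
                    Real.log (B16ZLower.zNorm V.G (X.g₀ ^ 2) (X.g₀ * p0Profile A₀ X.p₀ X.g₀)) - X.E)))) ρ₁ :=
  h.drop248.isRT_eq111 X.i0 hd h01 h.adm110 hav hU1 hcd hg₀ X.E

/-- [15] Theorem 1 out of the bundle for the (1.12) family, its existence clause unfolded by name: there are constants
`a₀, a₁, B₃` (chosen before the instance) such that for every instance and every boundary datum regular at `ε₁ ≦ a₁` a minimal
orbit exists — print's «there exists exactly one critical point of (1.12) … It is a minimum of (1.12)» rests on this and on the
uniqueness clause of the same theorem. [cite: Balaban1988Convergent, (1.12) p.248; Balaban1985Variational, Thm 1 p.279] -/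
theorem Hyp.exists_minimal_orbit (h : Hyp V X) :
    ∃ a₁ B₃ : ℝ, 0 < a₁ ∧ 0 < B₃ ∧ ∀ i : X.I15, ∀ ε₁ : ℝ, 0 < ε₁ → ε₁ ≤ a₁ →
      ∀ W : (X.fam15 i).Bdry, (X.fam15 i).Reg7 ε₁ W →
        ∃ U : (X.fam15 i).Cfg, (X.fam15 i).InU (B₃ * ε₁) U ∧ (X.fam15 i).InB W U ∧
          (X.fam15 i).OnMinimalOrbit (B₃ * ε₁) W U := by
  obtain ⟨a₀, a₁, B₃, B₄, Mfun, _, ha₁, hB₃, _, _, _, hall⟩ := h.thm1_15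
  exact ⟨a₁, B₃, ha₁, hB₃, fun i ε₁ hε hε₁ W hW => (hall i ε₁ hε hε₁ W hW).1⟩

/-- The boundary-term member under the LITERAL volume token: if the carrier's `vol253` is `|Λ₁ ∩ Λ₁ᶜ|` for some finite site set
`Λ₁`, the bundle forces `𝐁^{(1)} ≡ 0` (`boundaryTerm253_literal`) — recorded so that a consumer instantiates `vol253` with the
intended layer volume, not with the printed token. [cite: Balaban1988Convergent, p.253 ll.12–15] -/
theorem Hyp.bdry253_literal (h : Hyp V X) {α : Type*} [Fintype α] [DecidableEq α] (Λ₁ : Finset α)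
    (hvol : X.vol253 = ((Λ₁ ∩ Λ₁ᶜ).card : ℝ)) (a : X.Cfg253) : X.B253 a = 0 := by
  have hb := h.bdry253 a
  rw [hvol] at hb
  exact boundaryTerm253_literal Λ₁ hb

/-- `Hyp` ↔ the 9-fold conjunction of its members — the block's printed statements p. 244, Theorem p. 245, p. 246, (1.6), (1.10),
p. 248 (two), p. 252, p. 253 (for consumers who destructure by `obtain`). [cite: Balaban1988Convergent, p.244, Theorem p.245, (1.2) p.246, (1.6) p.247, (1.10)–(1.12) p.248, p.252, p.253] -/
theorem hyp_iff :
    Hyp V X ↔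
      ROpLeaf V ∧ B14.ThmP245PrintedI X.T X.ρ V.S V.Scorr V.K ∧ U1locDependsOn X.D1 X.vars4 ∧
        Eq16 X.D1 (X.T 0).T X.g₀ X.ε₀ X.ε₁ X.z X.E ∧ B14.Eq111Resummation.Geom.Adm110 X.D1 X.X1 ∧
        Drop248Printed X.inst X.A₁ X.p₀ ∧ B11.Thm1Printed X.fam15 ∧
        SmallS1Terms252Printed X.v252 ∧ (∀ a : X.Cfg253, BoundaryTerm253Printed (X.B253 a) X.C253 X.vol253) :=
  ⟨fun h => ⟨h.r244, h.thm245, h.dep12, h.eq16, h.adm110, h.drop248, h.thm1_15, h.smallS1, h.bdry253⟩,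
    fun ⟨h1, h2, h3, h4, h5, h6, h7, h8, h9⟩ => ⟨h1, h2, h3, h4, h5, h6, h7, h8, h9⟩⟩

end Literature.MathematicalPhysics.QuantumFieldTheory.Balaban1983to89.B14Carve33Sects01Hyp

end
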